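import Literature.NumberTheory.EllipticCurves.DegreeConjectureAbcMurtyProofs
import Literature.NumberTheory.Automorphic.ShimuraCurveRibetTakahashiFreyManinProofs
import Literature.NumberTheory.Automorphic.ShimuraCurveRibetTakahashiPeterssonFreyHellegouarchProofs
import Literature.NumberTheory.EllipticCurves.NeronIsogenyScalingHoldsProofs
import Summits.ABC.ABC.Statement
import Summits.ABC.ABC.Theses.DefiniteXi
import HarnessLib

/-!
# Crux `SteinbergCore` (stmt-ABC-15024), line `p6_tamagawa_split` — stub `stub_primeToSixDegreeBound` (P6):
# the abc-calibration ladder `ABC ⟹ FreyDegreeBound ⟹ P6` modulo NAMED, true-in-print facts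

Helper file for `--supports stmt-ABC-15024` (never the verbatim stub header: P6 is abc-strength).
Content = the k1 stub-ideation work-file `Cruxes/SteinbergCore/STUB_IDEAS_stub_primeToSixDegreeBound_1_g2.lean`
(gens 1–2, 2026-08-31, all PROVED there) RE-HOMED under a `Theorems` namespace so that a prover can land it as is;
re-verified against the check farm on 2026-08-31 (stub-ideation k2 gen 12): imports built, rc 0, 0 sorry.

* the registered stub statement (`P6TamagawaSplit.stub_primeToSixDegreeBound`) and the two analytic inputs (abc in the
  `≤`-currency; the Frey Petersson upper bound) are stated INLINE — no new `def : Prop` (no vendored-fact lint).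
* `freyPeterssonUpper_of_modularity` (G1): the Petersson UPPER bound `(f,f) ≪_t N^{1+t}` for newforms of Frey
  curves from modularity (`exists_isNewformOf`) via Mai–Murty as landed
  (`exists_petersson_le_mul_rpow_of_exists_isNewformOf`) + the Diamond–Kramer `64`-dichotomy.
* `modularDegree_le_maninSq_rpow_of_abcLe_of_freyPetersson` (G2): Murty's Thm 1(ii) per datum, Manin constant explicit,
  Petersson hypothesis restricted to Frey curves (copy of the tree proof
  `modularDegree_le_maninSq_rpow_of_abcLe_of_petersson`, `DegreeConjectureAbcMurtyConverseProofs`).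
* `p6_of_ABC_of_facts` (G3), `freyDegreeBound_of_ABC_of_facts` (G4): `ABC ⟹ P6` and `ABC ⟹ FreyDegreeBound` (route
  target stmt-ABC-2019) modulo `exists_isNewformOf` (BCDT), `PastenShimura2024_cor_10_2`,
  `exists_optimal_modularParametrizationData`, `mazurKenku_exists_cyclic_isogeny` — no anonymous analytic hypothesis.
The converse rungs are LANDED: `Summit.ABC.ABC.Theorems.SteinbergCorePrimeRung.primeToSixDegreeBound_of_freyDegreeBound`
(`FreyDegreeBound → P6`, p162616) and `…SteinbergCoreThesisCalibrationItems.steinbergCore_iff_freyDegreeBound_of_items'`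
(p163296); together: P6 ≡ FreyDegreeBound ≡ abc|Frey modulo the route's own binders.
[cite: MurtyCongruencePrimes1999, Thm 1] [cite: PastenShimura2024, Cor. 10.2] [cite: MaiMurty1994, §2]
-/

noncomputable section

-- `Summit.<Summit>.<Problem>` is the mandated summit-side namespace (CONVENTIONS §2); for the single-conjunct summit `ABC` the two coincide, so the duplicate `ABC.ABC` is deliberate.
set_option linter.dupNamespace false

open scoped MatrixGroups

namespace Summit.ABC.ABC.Theorems.SteinbergCoreP6Ladder

open Literature.NumberTheory.EllipticCurves Literature.NumberTheory.EllipticCurves.ModularForms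
open Literature.NumberTheory.DiophantineGeometry Literature.NumberTheory.Automorphic
open CongruenceSubgroup UniqueFactorizationMonoid IsDedekindDomain WeierstrassCurve NumberField

/-- The summit (strict form, `0 < C`) gives the `≤`-form. [folklore] -/
theorem abcLe_of_ABC (h : _root_.ABC) :
    ∀ ε : ℝ, 0 < ε → ∃ C : ℝ, ∀ a b c : ℕ, IsABCTriple a b c →
      (c : ℝ) ≤ C * ((rad a b c : ℕ) : ℝ) ^ (1 + ε) := by
  intro ε hε
  obtain ⟨C, -, hC⟩ := (ABC_iff.mp h) ε hε
  exact ⟨C, fun a b c habc => (hC a b c habc).le⟩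

/-- **G1 (PROVED)**: the Frey Petersson upper bound `(f,f) ≤ C₂(t)·N^{1+t}` (every `t > 0`) from the Modularity theorem (`exists_isNewformOf`, BCDT)
— Mai–Murty 1994 §2 as landed in the tree (`exists_petersson_le_mul_rpow_of_exists_isNewformOf`):
its hypotheses (i) `p² ∤ N` for odd `p` (`conductorNorm_freyCurve_dvd_holds`: `N ∣ 2⁸ rad`),
(ii) `64 ∤ N ∨ 64 ∤ N(E^{(−1)})` (`not_sixtyfour_dvd_conductorNorm_freyCurve_or_quadraticTwist_neg_one`,
all signs of `a, b`) hold for every Frey curve; exponent `δ = min t 1 ≤ t`. -/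
theorem freyPeterssonUpper_of_modularity (hmod : exists_isNewformOf) :
    ∀ t : ℝ, 0 < t → ∃ C₂ : ℝ, ∀ a b : ℤ, IsCoprime a b → a * b * (a + b) ≠ 0 →
      ∀ (N : ℕ) [NeZero N], (freyCurve a b).conductorNorm ℤ = N →
        ∀ f : CuspForm (Gamma0 N) 2, IsNewformOf (freyCurve a b) f →
          (peterssonProduct (Gamma0 N) 2 f f).re ≤ C₂ * (N : ℝ) ^ (1 + t) := by
  obtain ⟨C, hC, hmain⟩ := exists_petersson_le_mul_rpow_of_exists_isNewformOf hmod
  intro t ht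
  have hδ : 0 < min t 1 := lt_min ht one_pos
  have hδ1 : min t 1 ≤ 1 := min_le_right _ _
  have hδt : min t 1 ≤ t := min_le_left _ _
  refine ⟨C / (min t 1) ^ 3, fun a b hab h0 N _ hN f hf => ?_⟩
  haveI := isElliptic_freyCurve h0
  -- (i) `N` is square-free away from `2`
  have hodd : ∀ p : ℕ, p.Prime → p ≠ 2 → ¬ p ^ 2 ∣ N := by
    intro p hp hp2 hdvd
    have hN' : N ∣ 2 ^ 8 * (radical (a * b * (a + b))).natAbs :=
      hN ▸ conductorNorm_freyCurve_dvd_holds a b hab h0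
    have hcop : (p ^ 2).Coprime (2 ^ 8) :=
      Nat.Coprime.pow 2 8 ((Nat.coprime_primes hp Nat.prime_two).mpr hp2)
    have h3 : p ^ 2 ∣ (radical (a * b * (a + b))).natAbs :=
      hcop.dvd_of_dvd_mul_left (hdvd.trans hN')
    have hsf : Squarefree (radical (a * b * (a + b))).natAbs :=
      Int.squarefree_natAbs.mpr squarefree_radical
    exact hp.ne_one (Nat.isUnit_iff.mp (hsf p (by rw [← sq]; exact h3)))
  -- (ii) the Diamond–Kramer `64`-dichotomy
  have hcase : ¬ 64 ∣ N ∨ ∃ d : ℤ, (d = -1 ∨ d = 2 ∨ d = -2) ∧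
      ¬ 64 ∣ ((freyCurve a b).quadraticTwist (d : ℚ)).conductorNorm ℤ := by
    rcases not_sixtyfour_dvd_conductorNorm_freyCurve_or_quadraticTwist_neg_one hab h0 with h | h
    · exact Or.inl (hN ▸ h)
    · refine Or.inr ⟨-1, Or.inl rfl, ?_⟩
      push_cast
      exact h
  have hN1 : (1 : ℝ) ≤ N := by exact_mod_cast NeZero.one_le (n := N)
  have h1 : (N : ℝ) ^ (1 + min t 1) ≤ (N : ℝ) ^ (1 + t) :=
    Real.rpow_le_rpow_of_exponent_le hN1 (by linarith)
  calc (peterssonProduct (Gamma0 N) 2 f f).re ≤ C * (N : ℝ) ^ (1 + min t 1) / (min t 1) ^ 3 :=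
        hmain (min t 1) hδ hδ1 N (freyCurve a b) f hf hodd hcase
    _ ≤ C * (N : ℝ) ^ (1 + t) / (min t 1) ^ 3 :=
        div_le_div_of_nonneg_right (mul_le_mul_of_nonneg_left h1 hC.le) (pow_pos hδ 3).le
    _ = C / (min t 1) ^ 3 * (N : ℝ) ^ (1 + t) := by ring

/-- **G2 (PROVED)**: Murty's Theorem 1 (ii) PER DATUM with the Manin constant
explicit and the Petersson hypothesis restricted to Frey curves — a copy of the tree's
`Literature.NumberTheory.EllipticCurves.modularDegree_le_maninSq_rpow_of_abcLe_of_petersson`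
(`DegreeConjectureAbcMurtyConverseProofs.lean`, l. 61–140), whose proof evaluates `hUp` only at
`(freyCurve a b, D.f, D.isNewformOf)` (l. 89–90), so the restriction costs nothing. -/
theorem modularDegree_le_maninSq_rpow_of_abcLe_of_freyPetersson {θ : ℝ}
    (hUp : ∃ C₂ : ℝ, ∀ a b : ℤ, IsCoprime a b → a * b * (a + b) ≠ 0 →
      ∀ (N : ℕ) [NeZero N], (freyCurve a b).conductorNorm ℤ = N →
        ∀ f : CuspForm (Gamma0 N) 2, IsNewformOf (freyCurve a b) f →
          (peterssonProduct (Gamma0 N) 2 f f).re ≤ C₂ * (N : ℝ) ^ (1 + θ))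
    (habc : ∀ ε : ℝ, 0 < ε → ∃ C : ℝ, ∀ a b c : ℕ, IsABCTriple a b c →
      (c : ℝ) ≤ C * ((rad a b c : ℕ) : ℝ) ^ (1 + ε)) :
    ∀ ε : ℝ, 0 < ε → ∃ C : ℝ, ∀ a b : ℤ, IsCoprime a b → a * b * (a + b) ≠ 0 →
      ∀ (N : ℕ) [NeZero N], (freyCurve a b).conductorNorm ℤ = N →
        ∀ D : ModularParametrizationData (freyCurve a b) N,
          (D.modularDegree : ℝ) ≤ C * (D.maninConstant : ℝ) ^ 2 * (N : ℝ) ^ (2 + θ + ε) := by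
  -- copy of the tree proof (`DegreeConjectureAbcMurtyConverseProofs`, l. 75–140); the ONLY change
  -- is the line `hP`, where the Frey-restricted `hUp` is evaluated at `(a, b, N, D.f)`.
  intro ε hε
  obtain ⟨C₂, hC₂⟩ := hUp
  obtain ⟨Cabc, hCabc1, hCabc⟩ := abc_int_of_abcLe habc hε
  have hCabc0 : 0 ≤ Cabc := zero_le_one.trans hCabc1
  obtain ⟨A, hA, hSil⟩ := covolume_rpow_neg_six_le_of_isNeronLatticeOf
  set K : ℝ := 4 * Real.pi ^ 2 * max C₂ 0 * ((331776 * A) ^ (1 / 6 : ℝ) * (Cabc * 2 ^ (1 + ε)))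
    with hK
  refine ⟨K, fun a b hab h0 N _ hN D ↦ ?_⟩
  haveI := isElliptic_freyCurve h0
  have hNpos : (0 : ℝ) < N := by exact_mod_cast Nat.pos_of_ne_zero (NeZero.ne N)
  -- Zagier's identity `4π² c² (f,f) = deg · covol`
  have hZ := congrArg Complex.re D.zagier_degree_formula_holds
  rw [Complex.re_ofReal_mul, Complex.ofReal_re] at hZ
  have hP0 : 0 ≤ (peterssonProduct (Gamma0 N) 2 D.f D.f).re :=
    D.zagier_degree_formula_holds.peterssonProduct_re_pos.le
  have hcov : 0 < ZLattice.covolume D.L.lattice := ZLattice.covolume_pos _ _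
  -- the Petersson upper bound (Frey-restricted hypothesis, evaluated at this Frey curve)
  have hP : (peterssonProduct (Gamma0 N) 2 D.f D.f).re ≤ max C₂ 0 * (N : ℝ) ^ (1 + θ) :=
    (hC₂ a b hab h0 N hN D.f D.isNewformOf).trans
      (mul_le_mul_of_nonneg_right (le_max_left _ _) (by positivity))
  -- abc for the triple `a + b + (−(a+b)) = 0`
  have ha0 : a ≠ 0 := fun h ↦ h0 (by simp [h])
  have hb0 : b ≠ 0 := fun h ↦ h0 (by simp [h])
  have hab0 : a + b ≠ 0 := fun h ↦ h0 (by simp [h])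
  obtain ⟨haR, hbR, -⟩ := hCabc a b (-(a + b)) ha0 hb0 (neg_ne_zero.mpr hab0) hab (by ring)
  have hnat : (a * b * -(a + b)).natAbs = (a * b * (a + b)).natAbs := by
    rw [show a * b * -(a + b) = -(a * b * (a + b)) by ring, Int.natAbs_neg]
  rw [hnat, Nat.cast_natAbs, Int.cast_abs] at haR hbR
  set R' : ℝ := Cabc * ((radical (a * b * (a + b)).natAbs : ℕ) : ℝ) ^ (1 + ε) with hR'
  have hR'0 : 0 ≤ R' := (abs_nonneg _).trans haR
  -- Silverman on the Frey model: `covol⁻¹ ≤ (331776 A)^{1/6} R'`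
  have h6 : ZLattice.covolume D.L.lattice ^ (-(6 : ℝ)) ≤ (331776 * A) * R' ^ 6 := by
    calc ZLattice.covolume D.L.lattice ^ (-(6 : ℝ))
        ≤ A * ((max (|(freyCurve a b).c₄| ^ 3) (|(freyCurve a b).c₆| ^ 2) : ℚ) : ℝ) :=
          hSil (freyCurve a b) D.L D.isNeronLattice
      _ ≤ A * (331776 * R' ^ 6) := mul_le_mul_of_nonneg_left (max_c₄_c₆_freyCurve_le haR hbR) hA.le
      _ = 331776 * A * R' ^ 6 := by ring
  have hinv := inv_le_of_rpow_neg_six_le hcov (by positivity) hR'0 h6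
  -- the degree bound with `R'`, Manin constant kept (`|c| ≤ |c|`)
  have hdeg := deg_le_of_zagier_of_upper hcov hZ le_rfl hP0 hP hinv
  -- `rad(ab(a+b)) ≤ 2N`
  have hrN : ((radical (a * b * (a + b)).natAbs : ℕ) : ℝ) ≤ 2 * N := by
    have hdvd := radical_natAbs_dvd_two_mul_conductorNorm_freyCurve hab h0
    rw [hN] at hdvd
    exact_mod_cast Nat.le_of_dvd (Nat.pos_of_ne_zero (mul_ne_zero two_ne_zero (NeZero.ne N))) hdvd
  have hR'le : R' ≤ Cabc * 2 ^ (1 + ε) * (N : ℝ) ^ (1 + ε) := by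
    rw [hR']
    calc Cabc * ((radical (a * b * (a + b)).natAbs : ℕ) : ℝ) ^ (1 + ε)
        ≤ Cabc * (2 * (N : ℝ)) ^ (1 + ε) :=
          mul_le_mul_of_nonneg_left (Real.rpow_le_rpow (by positivity) hrN (by positivity)) hCabc0
      _ = Cabc * 2 ^ (1 + ε) * (N : ℝ) ^ (1 + ε) := by
          rw [Real.mul_rpow (by norm_num) hNpos.le]; ring
  have hexp : (N : ℝ) ^ (1 + θ) * (N : ℝ) ^ (1 + ε) = (N : ℝ) ^ (2 + θ + ε) := by
    rw [← Real.rpow_add hNpos]; congr 1; ring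
  have hsq : |(D.c : ℝ)| ^ 2 = (D.maninConstant : ℝ) ^ 2 := sq_abs _
  -- assemble
  calc (D.modularDegree : ℝ) = (D.deg : ℝ) := rfl
    _ ≤ 4 * Real.pi ^ 2 * |(D.c : ℝ)| ^ 2 * (max C₂ 0 * (N : ℝ) ^ (1 + θ)) *
          ((331776 * A) ^ (1 / 6 : ℝ) * R') := hdeg
    _ ≤ 4 * Real.pi ^ 2 * |(D.c : ℝ)| ^ 2 * (max C₂ 0 * (N : ℝ) ^ (1 + θ)) *
          ((331776 * A) ^ (1 / 6 : ℝ) * (Cabc * 2 ^ (1 + ε) * (N : ℝ) ^ (1 + ε))) := by gcongr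
    _ = K * |(D.c : ℝ)| ^ 2 * ((N : ℝ) ^ (1 + θ) * (N : ℝ) ^ (1 + ε)) := by rw [hK]; ring
    _ = K * (D.maninConstant : ℝ) ^ 2 * (N : ℝ) ^ (2 + θ + ε) := by rw [hexp, hsq]

/-- **G3 (PROVED — assembly)**: `ABC ⟹ P6` modulo NAMED, true-in-print facts of
the tree only — modularity (`exists_isNewformOf`, BCDT 2001), Pasten 2024 Cor. 10.2
(`PastenShimura2024_cor_10_2`), the optimal datum (`exists_optimal_modularParametrizationData`),
Mazur–Kenku (`mazurKenku_exists_cyclic_isogeny`); the Néron mapping property is DISCHARGED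
(`integral_neronScaling_of_isGloballyMinimal_holds`). No anonymous analytic hypothesis. -/
theorem p6_of_ABC_of_facts (hmod : exists_isNewformOf) (h102 : PastenShimura2024_cor_10_2)
    (hopt : exists_optimal_modularParametrizationData) (hMK : mazurKenku_exists_cyclic_isogeny)
    (h : _root_.ABC) :
    ∀ ε : ℝ, 0 < ε → ∃ C : ℝ, ∀ a b : ℤ, IsCoprime a b → a * b * (a + b) ≠ 0 → ∀ (N : ℕ) [NeZero N],
      (Literature.NumberTheory.EllipticCurves.freyCurve a b).conductorNorm ℤ = N →
      ∀ D : Literature.NumberTheory.EllipticCurves.ModularForms.ModularParametrizationData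
        (Literature.NumberTheory.EllipticCurves.freyCurve a b) N,
        (∀ D' : Literature.NumberTheory.EllipticCurves.ModularForms.ModularParametrizationData
          (Literature.NumberTheory.EllipticCurves.freyCurve a b) N, D.deg ≤ D'.deg) →
        ((D.deg / (ordProj[2] D.deg * ordProj[3] D.deg) : ℕ) : ℝ) ≤ C * (N : ℝ) ^ (2 + ε) := by
  obtain ⟨M, hM⟩ := PastenShimura2024_cor_10_2.exists_freyCurve_datum_maninConstant_le h102 hopt
    hMK integral_neronScaling_of_isGloballyMinimal_holds
  have hUpF := freyPeterssonUpper_of_modularity hmod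
  intro ε hε
  have hε2 : 0 < ε / 2 := half_pos hε
  obtain ⟨C, hC⟩ := modularDegree_le_maninSq_rpow_of_abcLe_of_freyPetersson (θ := ε / 2)
    (hUpF (ε / 2) hε2) (abcLe_of_ABC h) (ε / 2) hε2
  refine ⟨max C 0 * (M : ℝ) ^ 2, fun a b hab h0 N _ hN D hDmin => ?_⟩
  obtain ⟨D₀, hD₀⟩ := hM a b hab h0 N hN
  have hNpos : (0 : ℝ) < N := by exact_mod_cast Nat.pos_of_ne_zero (NeZero.ne N)
  have hrpow : (0 : ℝ) ≤ (N : ℝ) ^ (2 + ε) := Real.rpow_nonneg hNpos.le _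
  have h0' : (((D.deg / (ordProj[2] D.deg * ordProj[3] D.deg) : ℕ) : ℝ)) ≤ (D.deg : ℝ) := by
    exact_mod_cast Nat.div_le_self _ _
  have h1 : (D.deg : ℝ) ≤ (D₀.deg : ℝ) := by exact_mod_cast hDmin D₀
  have h2 : (D₀.modularDegree : ℝ) ≤
      C * (D₀.maninConstant : ℝ) ^ 2 * (N : ℝ) ^ (2 + ε / 2 + ε / 2) := hC a b hab h0 N hN D₀
  rw [show (2 : ℝ) + ε / 2 + ε / 2 = 2 + ε by ring] at h2
  have hcZ : |D₀.maninConstant| ≤ (M : ℤ) := by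
    rw [Int.abs_eq_natAbs]; exact_mod_cast hD₀
  have hcR : |(D₀.maninConstant : ℝ)| ≤ (M : ℝ) := by
    have := (Int.cast_le (R := ℝ)).mpr hcZ
    simpa [Int.cast_abs] using this
  have hc : (D₀.maninConstant : ℝ) ^ 2 ≤ (M : ℝ) ^ 2 := by
    calc (D₀.maninConstant : ℝ) ^ 2 = |(D₀.maninConstant : ℝ)| ^ 2 := (sq_abs _).symm
      _ ≤ (M : ℝ) ^ 2 := pow_le_pow_left₀ (abs_nonneg _) hcR 2
  calc (((D.deg / (ordProj[2] D.deg * ordProj[3] D.deg) : ℕ) : ℝ)) ≤ (D₀.deg : ℝ) := h0'.trans h1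
    _ = (D₀.modularDegree : ℝ) := rfl
    _ ≤ C * (D₀.maninConstant : ℝ) ^ 2 * (N : ℝ) ^ (2 + ε) := h2
    _ ≤ max C 0 * (D₀.maninConstant : ℝ) ^ 2 * (N : ℝ) ^ (2 + ε) := by
        apply mul_le_mul_of_nonneg_right _ hrpow
        exact mul_le_mul_of_nonneg_right (le_max_left _ _) (sq_nonneg _)
    _ ≤ max C 0 * (M : ℝ) ^ 2 * (N : ℝ) ^ (2 + ε) := by
        apply mul_le_mul_of_nonneg_right _ hrpow
        exact mul_le_mul_of_nonneg_left hc (le_max_right _ _)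

/-- **G3' (PROVED — calibration certificate, upper slice)**: `ABC ⟹ P6` modulo the all-curves
Petersson upper bound `hUp` (Rankin–Selberg / Hoffstein–Lockhart; verbatim the hypothesis of the
tree's `abcLe_imp_freyDegreeConjecture_of_petersson_of_manin`) and the three named facts; the Manin
input is the tree THEOREM `PastenShimura2024_cor_10_2.exists_freyCurve_datum_maninConstant_le`. -/
theorem p6_of_ABC_of_petersson_of_facts
    (hUp : ∀ t : ℝ, 0 < t → ∃ C₂ : ℝ, ∀ (N : ℕ) [NeZero N] (W : WeierstrassCurve ℚ) [W.IsElliptic]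
      (f : CuspForm (Gamma0 N) 2), IsNewformOf W f →
        (peterssonProduct (Gamma0 N) 2 f f).re ≤ C₂ * (N : ℝ) ^ (1 + t))
    (h102 : PastenShimura2024_cor_10_2) (hopt : exists_optimal_modularParametrizationData)
    (hMK : mazurKenku_exists_cyclic_isogeny) (h : _root_.ABC) :
    ∀ ε : ℝ, 0 < ε → ∃ C : ℝ, ∀ a b : ℤ, IsCoprime a b → a * b * (a + b) ≠ 0 → ∀ (N : ℕ) [NeZero N],
      (Literature.NumberTheory.EllipticCurves.freyCurve a b).conductorNorm ℤ = N →
      ∀ D : Literature.NumberTheory.EllipticCurves.ModularForms.ModularParametrizationData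
        (Literature.NumberTheory.EllipticCurves.freyCurve a b) N,
        (∀ D' : Literature.NumberTheory.EllipticCurves.ModularForms.ModularParametrizationData
          (Literature.NumberTheory.EllipticCurves.freyCurve a b) N, D.deg ≤ D'.deg) →
        ((D.deg / (ordProj[2] D.deg * ordProj[3] D.deg) : ℕ) : ℝ) ≤ C * (N : ℝ) ^ (2 + ε) := by
  have hM := PastenShimura2024_cor_10_2.exists_freyCurve_datum_maninConstant_le h102 hopt hMK
    integral_neronScaling_of_isGloballyMinimal_holds
  have hF := abcLe_imp_freyDegreeConjecture_of_petersson_of_manin hUp hM (abcLe_of_ABC h)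
  intro ε hε
  obtain ⟨C, hC⟩ := hF ε hε
  refine ⟨C, fun a b hab h0 N _ hN D hDmin => ?_⟩
  obtain ⟨D₀, hD₀⟩ := hC a b hab h0 N hN
  have h0' : (((D.deg / (ordProj[2] D.deg * ordProj[3] D.deg) : ℕ) : ℝ)) ≤ (D.deg : ℝ) := by
    exact_mod_cast Nat.div_le_self _ _
  have h1 : (D.deg : ℝ) ≤ (D₀.deg : ℝ) := by exact_mod_cast hDmin D₀
  exact h0'.trans (h1.trans hD₀)

/-- **G4 (PROVED — route-target corollary)**: the route TARGET `DefiniteXi.FreyDegreeBound`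
(stmt-ABC-2019) from `ABC` over the same NAMED facts — i.e. the `ABC ⟹ X` half of the route's
calibration with the Petersson UPPER bound discharged (previously carried as an anonymous all-curves
`hUp` in `DefiniteXiPolyFreyDegreeSandwich` / `…BakerShape`). With the landed
`Strategist.primeToSix_of_freyDegreeBound` (`Cruxes/SteinbergCore/AtomModuloBets.lean`) this
re-derives `G3`. -/
theorem freyDegreeBound_of_ABC_of_facts (hmod : exists_isNewformOf)
    (h102 : PastenShimura2024_cor_10_2) (hopt : exists_optimal_modularParametrizationData)
    (hMK : mazurKenku_exists_cyclic_isogeny) (h : _root_.ABC) :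
    Summit.ABC.ABC.Theses.DefiniteXi.FreyDegreeBound := by
  obtain ⟨M, hM⟩ := PastenShimura2024_cor_10_2.exists_freyCurve_datum_maninConstant_le h102 hopt
    hMK integral_neronScaling_of_isGloballyMinimal_holds
  have hUpF := freyPeterssonUpper_of_modularity hmod
  intro ε hε
  have hε2 : 0 < ε / 2 := half_pos hε
  obtain ⟨C, hC⟩ := modularDegree_le_maninSq_rpow_of_abcLe_of_freyPetersson (θ := ε / 2)
    (hUpF (ε / 2) hε2) (abcLe_of_ABC h) (ε / 2) hε2
  refine ⟨max C 0 * (M : ℝ) ^ 2, fun a b hab h0 N _ hN => ?_⟩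
  obtain ⟨D₀, hD₀⟩ := hM a b hab h0 N hN
  refine ⟨D₀, ?_⟩
  have hNpos : (0 : ℝ) < N := by exact_mod_cast Nat.pos_of_ne_zero (NeZero.ne N)
  have hrpow : (0 : ℝ) ≤ (N : ℝ) ^ (2 + ε) := Real.rpow_nonneg hNpos.le _
  have h2 : (D₀.modularDegree : ℝ) ≤
      C * (D₀.maninConstant : ℝ) ^ 2 * (N : ℝ) ^ (2 + ε / 2 + ε / 2) := hC a b hab h0 N hN D₀
  rw [show (2 : ℝ) + ε / 2 + ε / 2 = 2 + ε by ring] at h2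
  have hcZ : |D₀.maninConstant| ≤ (M : ℤ) := by
    rw [Int.abs_eq_natAbs]; exact_mod_cast hD₀
  have hcR : |(D₀.maninConstant : ℝ)| ≤ (M : ℝ) := by
    have := (Int.cast_le (R := ℝ)).mpr hcZ
    simpa [Int.cast_abs] using this
  have hc : (D₀.maninConstant : ℝ) ^ 2 ≤ (M : ℝ) ^ 2 := by
    calc (D₀.maninConstant : ℝ) ^ 2 = |(D₀.maninConstant : ℝ)| ^ 2 := (sq_abs _).symm
      _ ≤ (M : ℝ) ^ 2 := pow_le_pow_left₀ (abs_nonneg _) hcR 2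
  calc ((D₀.deg : ℕ) : ℝ) = (D₀.modularDegree : ℝ) := rfl
    _ ≤ C * (D₀.maninConstant : ℝ) ^ 2 * (N : ℝ) ^ (2 + ε) := h2
    _ ≤ max C 0 * (D₀.maninConstant : ℝ) ^ 2 * (N : ℝ) ^ (2 + ε) := by
        apply mul_le_mul_of_nonneg_right _ hrpow
        exact mul_le_mul_of_nonneg_right (le_max_left _ _) (sq_nonneg _)
    _ ≤ max C 0 * (M : ℝ) ^ 2 * (N : ℝ) ^ (2 + ε) := by
        apply mul_le_mul_of_nonneg_right _ hrpow
        exact mul_le_mul_of_nonneg_left hc (le_max_right _ _)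



end Summit.ABC.ABC.Theorems.SteinbergCoreP6Ladder

end
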